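import Literature.AlgebraicGeometry.Tropical.TorusCycles

/-!
# Crux `TropicalHodgeBound` (stmt-HodgeConjecture-18480), stub 4 — part H: tropical cycle classes are
# killed by the eigenwave (Mikhalkin–Zharkov Thm. 5.4, cell by cell)

Route `TropicalWeilObstruction` of `HodgeConjecture`, registered line `birth`
(`Cruxes/TropicalHodgeBound/Lines/birth.lean`), stub `stub_rationalHodgeCoordinates`; ingredient (H).

The eigenwave `φ : ⋀ᵖ ⊗ ⋀ᵖ → ⋀ᵖ⁺¹ ⊗ ⋀ᵖ⁻¹` of a tropical torus moves one vector of the SECOND (tangent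
frame) factor of `⋀ᵖℝᵍ ⊗ ⋀ᵖℤᵍ` into the FIRST (position) factor. On the class
`a_σ vol_σ ⊗ vol_σ` of a single framed cell it vanishes, because every column `l_j` of the frame satisfies
`l_j ∧ vol_σ = 0`; hence it vanishes on the cycle class `cyc Z` of every effective tropical cycle
(Mikhalkin–Zharkov, Thm. 5.4: "tropical cycle classes are Hodge"). In the all-maps Plücker coordinates of
`TropicalTorusCycle.cyc` (`p = 4`):

`Σ_{m : Fin 5} (-1)^m · cyc Z (K' ∘ m.succAbove) (K'_m :: J') = 0` for all `K' : Fin 5 → Fin g`,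
`J' : Fin 3 → Fin g` (`cyc_eigenwave`).

The cell identity (`sum_pluckerCoord_mul_pluckerCoord_cons`) is the Laplace expansion of the
`(K'_m :: J')`-minor along its first row followed by the expansion, along the duplicated column, of a
`5 × 5` determinant with two equal columns. Pure determinant algebra; no definition, no named fact, no
sorry.

References: [MikhalkinZharkov2014Eigenwave] G. Mikhalkin, I. Zharkov, Tropical eigenwave and intermediate
Jacobians, LN UMI 15 (2014), §5.1 and Thm. 5.4; [Zharkov2020TropicalWeil] I. Zharkov, arXiv:2002.02347,
p. 2.
-/

set_option linter.dupNamespace false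

namespace Summit.HodgeConjecture.HodgeConjecture.Theorems.TropicalHodgeBound

open scoped BigOperators
open Matrix Literature.AlgebraicGeometry.Tropical

section Eigenwave

variable {g : ℕ}

/-- Laplace expansion of the Plücker coordinate at `k :: J'` along the row `k`:
`Δ_{k::J'}(L) = Σ_c (-1)^c L_{k,c} · det L[J', ĉ]`. [folklore] -/
theorem pluckerCoord_cons (L : Matrix (Fin g) (Fin 4) ℤ) (k : Fin g) (J' : Fin 3 → Fin g) :
    pluckerCoord L (Fin.cons k J') =
      ∑ c : Fin 4, (-1) ^ (c : ℕ) * L k c * (L.submatrix J' c.succAbove).det := by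
  unfold pluckerCoord
  rw [Matrix.det_succ_row_zero]
  refine Finset.sum_congr rfl fun c _ => ?_
  rfl

/-- The `5 × 5` determinant `det [L[K', c] | L[K', ·]]` (the column `c` prepended) vanishes, and its
expansion along the first column is `Σ_m (-1)^m L_{K'_m, c} Δ_{K' ∘ m̂}(L)`. [folklore] -/
theorem sum_mul_pluckerCoord_succAbove_eq_zero (L : Matrix (Fin g) (Fin 4) ℤ) (K' : Fin 5 → Fin g)
    (c : Fin 4) :
    ∑ m : Fin 5, (-1) ^ (m : ℕ) * L (K' m) c * pluckerCoord L (fun a => K' (m.succAbove a)) = 0 := by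
  -- the matrix with the column `c` prepended
  let A : Matrix (Fin 5) (Fin 5) ℤ :=
    Matrix.of fun m j => (Fin.cons (L (K' m) c) (fun j' : Fin 4 => L (K' m) j') : Fin 5 → ℤ) j
  have hA : A.det = 0 := by
    refine Matrix.det_zero_of_column_eq (Fin.succ_ne_zero c).symm (fun m => ?_)
    simp [A]
  have hexp : A.det = ∑ m : Fin 5, (-1) ^ (m : ℕ) * L (K' m) c *
      pluckerCoord L (fun a => K' (m.succAbove a)) := by
    rw [Matrix.det_succ_column_zero]
    refine Finset.sum_congr rfl fun m _ => ?_
    have h0 : A m 0 = L (K' m) c := by simp [A]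
    have hsub : A.submatrix m.succAbove Fin.succ = L.submatrix (fun a => K' (m.succAbove a)) id := by
      ext a j; simp [A]
    rw [h0, hsub]
    rfl
  rw [← hexp, hA]

/-- **The cell identity** (`l_j ∧ vol_σ = 0`): for an integer `g × 4` frame `L`,
`Σ_m (-1)^m Δ_{K'∘m̂}(L) · Δ_{K'_m :: J'}(L) = 0`. [cite: MikhalkinZharkov2014Eigenwave, Thm. 5.4] -/
theorem sum_pluckerCoord_mul_pluckerCoord_cons (L : Matrix (Fin g) (Fin 4) ℤ) (K' : Fin 5 → Fin g)
    (J' : Fin 3 → Fin g) :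
    ∑ m : Fin 5, (-1) ^ (m : ℕ) * pluckerCoord L (fun a => K' (m.succAbove a)) *
      pluckerCoord L (Fin.cons (K' m) J') = 0 := by
  calc ∑ m : Fin 5, (-1) ^ (m : ℕ) * pluckerCoord L (fun a => K' (m.succAbove a)) *
        pluckerCoord L (Fin.cons (K' m) J')
      = ∑ m : Fin 5, ∑ c : Fin 4, (-1) ^ (c : ℕ) * (L.submatrix J' c.succAbove).det *
          ((-1) ^ (m : ℕ) * L (K' m) c * pluckerCoord L (fun a => K' (m.succAbove a))) := by
        refine Finset.sum_congr rfl fun m _ => ?_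
        rw [pluckerCoord_cons, Finset.mul_sum]
        refine Finset.sum_congr rfl fun c _ => ?_
        ring
    _ = ∑ c : Fin 4, (-1) ^ (c : ℕ) * (L.submatrix J' c.succAbove).det *
          ∑ m : Fin 5, (-1) ^ (m : ℕ) * L (K' m) c * pluckerCoord L (fun a => K' (m.succAbove a)) := by
        rw [Finset.sum_comm]
        refine Finset.sum_congr rfl fun c _ => ?_
        rw [Finset.mul_sum]
    _ = 0 := Finset.sum_eq_zero fun c _ => by rw [sum_mul_pluckerCoord_succAbove_eq_zero, mul_zero]

variable {Q : Matrix (Fin g) (Fin g) ℝ}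

/-- **Tropical cycle classes are killed by the eigenwave** (Mikhalkin–Zharkov Thm. 5.4 in Plücker
coordinates): `Σ_m (-1)^m · cyc Z (K' ∘ m̂) (K'_m :: J') = 0`. [cite: MikhalkinZharkov2014Eigenwave, Thm. 5.4] -/
theorem cyc_eigenwave (Z : TropicalTorusCycle g 4 Q) (K' : Fin 5 → Fin g) (J' : Fin 3 → Fin g) :
    ∑ m : Fin 5, (-1 : ℝ) ^ (m : ℕ) *
      Z.cyc (fun a => K' (m.succAbove a)) (Fin.cons (K' m) J') = 0 := by
  unfold TropicalTorusCycle.cyc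
  calc ∑ m : Fin 5, (-1 : ℝ) ^ (m : ℕ) * ∑ σ, ((Z.cell σ).weight : ℝ) * (Z.cell σ).latticeVolume *
          (pluckerCoord (Z.cell σ).frame (fun a => K' (m.succAbove a)) : ℝ) *
            (pluckerCoord (Z.cell σ).frame (Fin.cons (K' m) J') : ℝ)
      = ∑ σ, ((Z.cell σ).weight : ℝ) * (Z.cell σ).latticeVolume *
          ((∑ m : Fin 5, (-1) ^ (m : ℕ) * pluckerCoord (Z.cell σ).frame (fun a => K' (m.succAbove a)) *
            pluckerCoord (Z.cell σ).frame (Fin.cons (K' m) J') : ℤ) : ℝ) := by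
        simp only [Finset.mul_sum]
        rw [Finset.sum_comm]
        refine Finset.sum_congr rfl fun σ _ => ?_
        push_cast
        rw [Finset.mul_sum]
        refine Finset.sum_congr rfl fun m _ => ?_
        ring
    _ = 0 := Finset.sum_eq_zero fun σ _ => by
        rw [sum_pluckerCoord_mul_pluckerCoord_cons]; simp

end Eigenwave

end Summit.HodgeConjecture.HodgeConjecture.Theorems.TropicalHodgeBound
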